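/-
Copyright (c) 2026. All rights reserved.
Released under Apache 2.0 license as described in the file LICENSE.
-/
import Literature.NumberTheory.GaloisRepresentations.Corestriction
import Literature.NumberTheory.GaloisRepresentations.ContinuousCohomologyNineTerm
import Literature.NumberTheory.GaloisRepresentations.ContinuousCohomologyVanishing
import Literature.NumberTheory.GaloisRepresentations.TateDualityCounting
import Mathlib.Data.Nat.Choose.Dvd
import HarnessLib

/-!
# The Euler–Poincaré characteristic along a normal subgroup of prime index

Let `G` be a profinite group, `S ⊴ G` an open normal subgroup of prime index `p`, and `M` a
finite discrete `G`-module killed by `p`, with `H¹(G, M)` and `H²(G, M)` finite and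
`H³(G, ·) = 0` on discrete `G`-modules killed by `p` (e.g. `cd_p(G) ≤ 2`). Writing
`hⁱ(·) = #Hⁱ(·, M)`, we prove the **multiplicativity of the truncated Euler–Poincaré
characteristic in a cyclic step of degree `p`**:

`h⁰(S) · h²(S) · h¹(G)^p = h¹(S) · (h⁰(G) · h²(G))^p`,

i.e. `χ(S, M) = χ(G, M)^p` for `χ = h⁰ h² / h¹`, together with the finiteness of `H¹(S, M)` and
`H²(S, M)`. This is the induction step of the classical reduction of Tate's local Euler–Poincaré
characteristic formula to the case where the image of the Galois group is of order prime to `p`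
(Serre, *Cohomologie galoisienne* II §5.7, Lemme 7 and the "dévissage" preceding it; Milne,
*Arithmetic Duality Theorems* I §2, proof of Thm. 2.8, Step 2).

## The argument

By Shapiro's lemma (`Corestriction`: `shMap`/`extMap`), `Hⁱ(S, M) = Hⁱ(G, I)` for the induced
module `I = M_G^S(M)` (`CoinducedModule`). On `I` the element `γ ∈ G ∖ S` acts by the
`G`-equivariant *twist* `(T F)(x) = γ · F(γ⁻¹ x)` with `T^p = 1`; since `p I = 0`,
`N = T - 1` satisfies `N^p = 0` and `N^{p-1} = 1 + T + ⋯ + T^{p-1}` (binomial coefficients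
mod `p`). The kernels `F_k = ker N^k` form a `G`-stable filtration `0 = F_0 ≤ ⋯ ≤ F_p = I` with
short exact sequences `0 → F_k → F_{k+1} → M → 0` (`F ↦ (N^k F)(1)`; surjectivity from the
functions supported on `S`), and the nine-term count `IsSES.card_nineTerm` gives
`χ(F_{k+1}) = χ(F_k) χ(M)` inductively.

## Main results

* `coindTwist`, `coindTwist_pow_index`: the twist and `T^{(G:S)} = 1`.
* `coindTwist_sub_one_pow_prime`, `coindTwist_sub_one_pow_prime_sub_one`: `N^p = 0`,
  `N^{p-1} = Σ T^j`.
* `eq_unitCoind_of_coindTwist_eq`: `ker N = M` (the unit `a ↦ (x ↦ x a)`).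
* `isSES_kerPow`: the short exact sequences `0 → F_k → F_{k+1} → M → 0`.
* `card_euler_cyclic_step`: the displayed identity; `finite_continuousCohomology_restrict_one/two`.
-/

noncomputable section

open CategoryTheory ContinuousCohomology Function

universe u

namespace Literature.NumberTheory.GaloisRepresentations

variable {G : Type u} [Group G] [TopologicalSpace G] [IsTopologicalGroup G] [CompactSpace G]
variable {M : Type u} [AddCommGroup M] [TopologicalSpace M] [DiscreteTopology M]
variable (S : Subgroup G) [S.Normal] (ρ : ContinuousRep G ℤ M)

attribute [local instance] discreteTopology_coind

/-! ### The twist `T_γ` on the induced module -/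

section Twist

/-- **The twist** `(T_γ F)(x) = γ · F(γ⁻¹ x)` on the induced module `M_G^S(M|_S)` of a discrete
`G`-module along a normal subgroup `S`; it is `G`-equivariant, multiplicative in `γ`, and trivial
for `γ ∈ S`, so that `G/S` acts on `M_G^S(M) ≅ M ⊗ ℤ[G/S]` through the second factor.
[cite: SerreGaloisCohomology1997, I §2.5] -/
def coindTwist (γ : G) :
    coindModule (ρ.restrict (subgroupIncl S)) →ₗ[ℤ] coindModule (ρ.restrict (subgroupIncl S)) where
  toFun F := ⟨((ρ.toTopRep.ρ γ : M →L[ℤ] M) : C(M, M)).comp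
      ((F : C(G, M)).comp ⟨fun x => γ⁻¹ * x, continuous_const.mul continuous_id⟩), fun s x => by
    change ρ γ ((F : C(G, M)) (γ⁻¹ * ((s : G) * x))) = ρ (subgroupIncl S s) (ρ γ ((F : C(G, M)) (γ⁻¹ * x)))
    have hs : γ⁻¹ * (s : G) * γ ∈ S := by
      have := Subgroup.Normal.conj_mem inferInstance (s : G) s.2 γ⁻¹
      rwa [inv_inv] at this
    have key := (mem_coind_iff (ρ.restrict (subgroupIncl S)) (F : C(G, M))).1 F.2 ⟨_, hs⟩ (γ⁻¹ * x)
    change (F : C(G, M)) (γ⁻¹ * (s : G) * γ * (γ⁻¹ * x)) = ρ (γ⁻¹ * (s : G) * γ) ((F : C(G, M)) (γ⁻¹ * x))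
      at key
    rw [subgroupIncl_apply]
    rw [show γ⁻¹ * ((s : G) * x) = γ⁻¹ * (s : G) * γ * (γ⁻¹ * x) by group, key, ← Module.End.mul_apply,
      ← map_mul, ← Module.End.mul_apply, ← map_mul]
    congr 2
    group⟩
  map_add' F F' := Subtype.ext (ContinuousMap.ext fun x => map_add (ρ γ) _ _)
  map_smul' c F := Subtype.ext (ContinuousMap.ext fun x => map_zsmul (ρ γ) c _)

omit [CompactSpace G] in
/-- Unfolding the twist. [folklore] -/
@[simp] theorem coindTwist_coe_apply (γ : G) (F : coindModule (ρ.restrict (subgroupIncl S))) (x : G) :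
    ((coindTwist S ρ γ F : coindModule (ρ.restrict (subgroupIncl S))) : C(G, M)) x =
      ρ γ ((F : C(G, M)) (γ⁻¹ * x)) := rfl

/-- The twist commutes with the `G`-action `(g F)(x) = F(x g)`. [folklore] -/
theorem coindTwist_comm (γ g : G) (F : coindModule (ρ.restrict (subgroupIncl S))) :
    coindTwist S ρ γ (coindRep (ρ.restrict (subgroupIncl S)) g F) =
      coindRep (ρ.restrict (subgroupIncl S)) g (coindTwist S ρ γ F) :=
  Subtype.ext (ContinuousMap.ext fun x => by
    rw [coindTwist_coe_apply, coindRep_apply_apply, coindRep_apply_apply, coindTwist_coe_apply, mul_assoc])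

/-- The twist commutes with the `G`-action, as endomorphisms. [folklore] -/
theorem commute_coindTwist (γ g : G) :
    Commute (coindTwist S ρ γ) (coindRep (ρ.restrict (subgroupIncl S)) g) :=
  LinearMap.ext fun F => coindTwist_comm S ρ γ g F

omit [CompactSpace G] in
/-- `T_1 = 1`. [folklore] -/
theorem coindTwist_one : coindTwist S ρ 1 = 1 :=
  LinearMap.ext fun F => Subtype.ext (ContinuousMap.ext fun x => by
    rw [coindTwist_coe_apply, inv_one, one_mul, map_one]; rfl)

omit [CompactSpace G] in
/-- `T_{γγ'} = T_γ T_γ'`. [folklore] -/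
theorem coindTwist_mul (γ γ' : G) : coindTwist S ρ (γ * γ') = coindTwist S ρ γ * coindTwist S ρ γ' :=
  LinearMap.ext fun F => Subtype.ext (ContinuousMap.ext fun x => by
    rw [Module.End.mul_apply, coindTwist_coe_apply, coindTwist_coe_apply, coindTwist_coe_apply, map_mul,
      Module.End.mul_apply, mul_inv_rev, mul_assoc])

omit [CompactSpace G] in
/-- `T_γ^n = T_{γ^n}`. [folklore] -/
theorem coindTwist_pow (γ : G) (n : ℕ) : coindTwist S ρ γ ^ n = coindTwist S ρ (γ ^ n) := by
  induction n with
  | zero => rw [pow_zero, pow_zero, coindTwist_one]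
  | succ n ih => rw [pow_succ, pow_succ, ih, coindTwist_mul]

omit [CompactSpace G] in
/-- `T_s = 1` for `s ∈ S`. [folklore] -/
theorem coindTwist_of_mem {γ : G} (hγ : γ ∈ S) (F : coindModule (ρ.restrict (subgroupIncl S))) :
    coindTwist S ρ γ F = F :=
  Subtype.ext (ContinuousMap.ext fun x => by
    have key := (mem_coind_iff (ρ.restrict (subgroupIncl S)) (F : C(G, M))).1 F.2 ⟨γ, hγ⟩ (γ⁻¹ * x)
    change (F : C(G, M)) (γ * (γ⁻¹ * x)) = ρ γ ((F : C(G, M)) (γ⁻¹ * x)) at key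
    rw [coindTwist_coe_apply, ← key, mul_inv_cancel_left])

omit [CompactSpace G] in
/-- **`T_γ^{(G:S)} = 1`.** [folklore] -/
theorem coindTwist_pow_index (γ : G) (F : coindModule (ρ.restrict (subgroupIncl S))) :
    (coindTwist S ρ γ ^ S.index) F = F := by
  rw [coindTwist_pow]
  exact coindTwist_of_mem S ρ (Subgroup.pow_index_mem S γ) F

end Twist

/-! ### Binomial identities modulo `p` -/

section Binomial

/-- `C(p-1, k) ≡ (-1)^k (mod p)` for `k < p`. [folklore] -/
theorem exists_choose_prime_sub_one_eq {p : ℕ} (hp : p.Prime) (k : ℕ) (hk : k < p) :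
    ∃ t : ℤ, ((p - 1).choose k : ℤ) = (-1) ^ k + p * t := by
  induction k with
  | zero => exact ⟨0, by simp⟩
  | succ k ih =>
    obtain ⟨t, ht⟩ := ih (k.lt_succ_self.trans hk)
    obtain ⟨c, hc⟩ := hp.dvd_choose_self k.succ_ne_zero hk
    have hpas : (p - 1).choose k + (p - 1).choose (k + 1) = p.choose (k + 1) := by
      conv_rhs => rw [← Nat.sub_add_cancel hp.one_le]
      exact (Nat.choose_succ_succ (p - 1) k).symm
    refine ⟨c - t, ?_⟩
    have : ((p - 1).choose (k + 1) : ℤ) = (p.choose (k + 1) : ℤ) - ((p - 1).choose k : ℤ) := by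
      rw [← hpas]; push_cast; ring
    rw [this, hc, ht]; push_cast; ring

variable {V : Type*} [AddCommGroup V]

/-- In an abelian group killed by the prime `p`, an endomorphism `T` with `T^p = 1` satisfies
`(T - 1)^p = 0`. [folklore] -/
theorem sub_one_pow_prime_apply_eq_zero {p : ℕ} (hp : p.Prime) (hV : ∀ v : V, p • v = 0)
    (T : Module.End ℤ V) (hT : ∀ v, (T ^ p) v = v) (v : V) : ((T - 1) ^ p) v = 0 := by
  have hcomm : Commute T (-1) := (Commute.one_right T).neg_right
  obtain ⟨q, rfl⟩ : ∃ q, p = q + 1 := ⟨p - 1, (Nat.sub_add_cancel hp.one_le).symm⟩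
  rw [sub_eq_add_neg, hcomm.add_pow, LinearMap.sum_apply, Finset.sum_range_succ, Finset.sum_range_succ']
  -- the middle terms vanish
  have hmid : ∀ k ∈ Finset.range q, (T ^ (k + 1) * (-1) ^ (q + 1 - (k + 1)) *
      ((q + 1).choose (k + 1) : Module.End ℤ V)) v = 0 := by
    intro k hk
    rw [Finset.mem_range] at hk
    obtain ⟨c, hc⟩ := hp.dvd_choose_self k.succ_ne_zero (by omega)
    rw [Module.End.mul_apply, hc, Module.End.natCast_apply, mul_comm, mul_nsmul, hV, map_zero]
  rw [Finset.sum_eq_zero hmid, zero_add]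
  simp only [pow_zero, Nat.sub_zero, Nat.choose_zero_right, Nat.sub_self, Nat.choose_self, Nat.cast_one, mul_one,
    one_mul]
  rw [hT]
  -- `(-1)^p v + v = 0`
  have hneg : ∀ (n : ℕ) (w : V), ((-1 : Module.End ℤ V) ^ n) w = ((-1 : ℤ) ^ n) • w := by
    intro n w
    induction n with
    | zero => rw [pow_zero, pow_zero, one_zsmul, Module.End.one_apply]
    | succ n ih => rw [pow_succ, Module.End.mul_apply, LinearMap.neg_apply, Module.End.one_apply, map_neg, ih,
        pow_succ, mul_neg_one, neg_zsmul]
  rw [hneg]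
  rcases hp.eq_two_or_odd' with h2 | hodd
  · obtain rfl : q = 1 := by omega
    rw [neg_one_sq, one_zsmul, ← two_nsmul, hV]
  · rw [hodd.neg_one_pow, neg_one_zsmul, neg_add_cancel]

/-- In an abelian group killed by the prime `p`, `(T - 1)^{p-1} = 1 + T + ⋯ + T^{p-1}` for every
endomorphism `T`. [folklore] -/
theorem sub_one_pow_prime_sub_one_apply {p : ℕ} (hp : p.Prime) (hV : ∀ v : V, p • v = 0)
    (T : Module.End ℤ V) (v : V) :
    ((T - 1) ^ (p - 1)) v = (Finset.range p).sum fun j => (T ^ j) v := by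
  have hcomm : Commute T (-1) := (Commute.one_right T).neg_right
  have hp1 : p - 1 + 1 = p := Nat.sub_add_cancel hp.one_le
  have hneg : ∀ (n : ℕ) (w : V), ((-1 : Module.End ℤ V) ^ n) w = ((-1 : ℤ) ^ n) • w := by
    intro n w
    induction n with
    | zero => rw [pow_zero, pow_zero, one_zsmul, Module.End.one_apply]
    | succ n ih => rw [pow_succ, Module.End.mul_apply, LinearMap.neg_apply, Module.End.one_apply, map_neg, ih,
        pow_succ, mul_neg_one, neg_zsmul]
  rw [sub_eq_add_neg, hcomm.add_pow, hp1, LinearMap.sum_apply]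
  refine Finset.sum_congr rfl fun k hk => ?_
  rw [Finset.mem_range] at hk
  obtain ⟨t, ht⟩ := exists_choose_prime_sub_one_eq hp k hk
  have hcoef : ((p - 1).choose k : Module.End ℤ V) v = ((-1 : ℤ) ^ k) • v := by
    rw [Module.End.natCast_apply, ← natCast_zsmul, ht, add_zsmul, mul_comm, mul_zsmul, natCast_zsmul, hV,
      zsmul_zero, add_zero]
  rw [Module.End.mul_apply, hcoef, Module.End.mul_apply, map_zsmul, map_zsmul, hneg, map_zsmul, smul_smul,
    ← pow_add, show k + (p - 1 - k) = p - 1 by omega]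
  rcases hp.eq_two_or_odd' with rfl | hodd
  · change ((-1 : ℤ) ^ 1) • (T ^ k) v = (T ^ k) v
    rw [pow_one, neg_one_zsmul, neg_eq_iff_add_eq_zero, ← two_nsmul, hV]
  · rw [(Nat.Odd.sub_odd hodd odd_one).neg_one_pow, one_zsmul]

end Binomial

/-! ### The kernel of `T - 1` and the functions supported on `S` -/

section Kernel

variable {S ρ}

omit [CompactSpace G] in
/-- An element of the induced module fixed by the twist `T_γ` satisfies `F(γ^j) = γ^j F(1)`.
[folklore] -/
theorem coe_apply_pow_of_coindTwist_eq {γ : G} {F : coindModule (ρ.restrict (subgroupIncl S))}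
    (hF : coindTwist S ρ γ F = F) (j : ℕ) : (F : C(G, M)) (γ ^ j) = ρ (γ ^ j) ((F : C(G, M)) 1) := by
  induction j with
  | zero => rw [pow_zero, _root_.map_one ρ, Module.End.one_apply]
  | succ j ih =>
    have := congrArg (fun F' : coindModule (ρ.restrict (subgroupIncl S)) => (F' : C(G, M)) (γ ^ (j + 1))) hF
    simp only [coindTwist_coe_apply] at this
    rw [← this, pow_succ', inv_mul_cancel_left, ih, ← Module.End.mul_apply, ← map_mul]

omit [TopologicalSpace G] [IsTopologicalGroup G] [CompactSpace G] in
/-- In `G` with `S ⊴ G` of prime index, every element is `s γ^j` for `γ ∉ S`. [folklore] -/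
theorem exists_eq_mul_pow_of_index_prime {p : ℕ} (hp : p.Prime) (hidx : S.index = p) {γ : G}
    (hγ : γ ∉ S) (x : G) : ∃ (s : G) (j : ℕ), s ∈ S ∧ x = s * γ ^ j := by
  haveI : Fact p.Prime := ⟨hp⟩
  have hcard : Nat.card (G ⧸ S) = p := by rw [← Subgroup.index_eq_card, hidx]
  haveI : Finite (G ⧸ S) := Nat.finite_of_card_ne_zero (hcard ▸ hp.ne_zero)
  have hne : (QuotientGroup.mk γ : G ⧸ S) ≠ 1 := fun h => hγ ((QuotientGroup.eq_one_iff γ).1 h)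
  have htop := zpowers_eq_top_of_prime_card hcard hne
  have hx : (QuotientGroup.mk x : G ⧸ S) ∈ Submonoid.powers (QuotientGroup.mk γ : G ⧸ S) := by
    rw [(isOfFinOrder_of_finite _).mem_powers_iff_mem_zpowers, htop]
    exact Subgroup.mem_top _
  obtain ⟨j, hj⟩ := Submonoid.mem_powers_iff _ _ |>.1 hx
  rw [← QuotientGroup.mk_pow, QuotientGroup.eq] at hj
  refine ⟨x * (γ ^ j)⁻¹, j, ?_, by rw [inv_mul_cancel_right]⟩
  have := Subgroup.Normal.conj_mem inferInstance _ hj (γ ^ j)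
  rwa [mul_inv_cancel_left] at this

omit [CompactSpace G] in
/-- **`ker (T_γ - 1)` is the module of functions `x ↦ x · a`**: an element of `M_G^S(M)` fixed by
the twist of a generator `γ` of `G/S` is the unit of its value at `1`. [folklore] -/
theorem eq_unitCoind_of_coindTwist_eq {p : ℕ} (hp : p.Prime) (hidx : S.index = p) {γ : G} (hγ : γ ∉ S)
    {F : coindModule (ρ.restrict (subgroupIncl S))} (hF : coindTwist S ρ γ F = F) :
    F = unitCoindFun ρ ((F : C(G, M)) 1) := by
  refine Subtype.ext (ContinuousMap.ext fun x => ?_)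
  obtain ⟨s, j, hs, rfl⟩ := exists_eq_mul_pow_of_index_prime hp hidx hγ x
  have key := (mem_coind_iff (ρ.restrict (subgroupIncl S)) (F : C(G, M))).1 F.2 ⟨s, hs⟩ (γ ^ j)
  change (F : C(G, M)) (s * γ ^ j) = ρ s ((F : C(G, M)) (γ ^ j)) at key
  rw [unitCoindFun_coe_apply, key, coe_apply_pow_of_coindTwist_eq hF, ← Module.End.mul_apply, ← map_mul]

omit [CompactSpace G] in
/-- An element of `ker (T_γ - 1)` vanishing at `1` vanishes. [folklore] -/
theorem eq_zero_of_coindTwist_eq_of_apply_one {p : ℕ} (hp : p.Prime) (hidx : S.index = p) {γ : G}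
    (hγ : γ ∉ S) {F : coindModule (ρ.restrict (subgroupIncl S))} (hF : coindTwist S ρ γ F = F)
    (h1 : (F : C(G, M)) 1 = 0) : F = 0 := by
  rw [eq_unitCoind_of_coindTwist_eq hp hidx hγ hF, h1]
  exact Subtype.ext (ContinuousMap.ext fun x => map_zero (ρ x))

omit [IsTopologicalGroup G] [CompactSpace G] in
/-- **The induced module is finite** for `M` finite and `S` of finite (prime) index: an element is
determined by its values on the powers of a generator of `G/S`. [folklore] -/
theorem finite_coindModule_of_index_prime {p : ℕ} (hp : p.Prime) (hidx : S.index = p) {γ : G}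
    (hγ : γ ∉ S) [Finite M] : Finite (coindModule (ρ.restrict (subgroupIncl S))) := by
  refine Finite.of_injective (fun (F : coindModule (ρ.restrict (subgroupIncl S))) (j : Fin p) =>
    (F : C(G, M)) (γ ^ (j : ℕ))) fun F F' h => ?_
  refine Subtype.ext (ContinuousMap.ext fun x => ?_)
  obtain ⟨s, j, hs, rfl⟩ := exists_eq_mul_pow_of_index_prime hp hidx hγ x
  have hγp : γ ^ p ∈ S := hidx ▸ Subgroup.pow_index_mem S γ
  -- reduce the exponent mod `p`
  have hred : ∀ F'' : coindModule (ρ.restrict (subgroupIncl S)),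
      (F'' : C(G, M)) (s * γ ^ j) = ρ (s * γ ^ (p * (j / p))) ((F'' : C(G, M)) (γ ^ (j % p))) := by
    intro F''
    have hmem : s * γ ^ (p * (j / p)) ∈ S := S.mul_mem hs (by rw [pow_mul]; exact S.pow_mem hγp _)
    have key := (mem_coind_iff (ρ.restrict (subgroupIncl S)) (F'' : C(G, M))).1 F''.2 ⟨_, hmem⟩ (γ ^ (j % p))
    change (F'' : C(G, M)) (s * γ ^ (p * (j / p)) * γ ^ (j % p)) =
      ρ (s * γ ^ (p * (j / p))) ((F'' : C(G, M)) (γ ^ (j % p))) at key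
    rw [← key, mul_assoc, ← pow_add, Nat.div_add_mod]
  have hj := congr_fun h ⟨j % p, Nat.mod_lt _ hp.pos⟩
  change (F : C(G, M)) (γ ^ (j % p)) = (F' : C(G, M)) (γ ^ (j % p)) at hj
  rw [hred F, hred F', hj]

variable (S ρ)

/-- The function `x ↦ x · m` on `S`, extended by zero: an element of `M_G^S(M)` supported on the
open subgroup `S`. [folklore] -/
def deltaCoind (hS : IsOpen (S : Set G)) (m : M) : coindModule (ρ.restrict (subgroupIncl S)) := by
  classical
  refine ⟨⟨(S : Set G).piecewise (fun x => ρ x m) 0, ?_⟩, fun s x => ?_⟩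
  · have hcl : IsClopen (S : Set G) := ⟨Subgroup.isClosed_of_isOpen S hS, hS⟩
    refine continuous_piecewise (fun a ha => ?_) (ρ.continuous_apply_left m).continuousOn continuousOn_const
    rw [hcl.frontier_eq] at ha
    exact absurd ha (Set.notMem_empty a)
  · change (S : Set G).piecewise (fun x => ρ x m) 0 ((s : G) * x) =
      ρ (subgroupIncl S s) ((S : Set G).piecewise (fun x => ρ x m) 0 x)
    rw [subgroupIncl_apply]
    by_cases hx : x ∈ S
    · rw [Set.piecewise_eq_of_mem _ _ _ (show (s : G) * x ∈ (S : Set G) from S.mul_mem s.2 hx),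
        Set.piecewise_eq_of_mem _ _ _ (show x ∈ (S : Set G) from hx), map_mul, Module.End.mul_apply]
    · have hsx : (s : G) * x ∉ S := fun h => hx (by simpa using S.mul_mem (S.inv_mem s.2) h)
      rw [Set.piecewise_eq_of_notMem _ _ _ (show (s : G) * x ∉ (S : Set G) from hsx),
        Set.piecewise_eq_of_notMem _ _ _ (show x ∉ (S : Set G) from hx), Pi.zero_apply, Pi.zero_apply, map_zero]

omit [CompactSpace G] [S.Normal] in
/-- `δ_m(x) = x · m` on `S`. [folklore] -/
theorem deltaCoind_apply_of_mem (hS : IsOpen (S : Set G)) (m : M) {x : G} (hx : x ∈ S) :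
    ((deltaCoind S ρ hS m : coindModule (ρ.restrict (subgroupIncl S))) : C(G, M)) x = ρ x m := by
  classical
  change (S : Set G).piecewise (fun x => ρ x m) 0 x = _
  convert Set.piecewise_eq_of_mem (S : Set G) (fun x => ρ x m) 0 (show x ∈ (S : Set G) from hx)

omit [CompactSpace G] [S.Normal] in
/-- `δ_m(x) = 0` off `S`. [folklore] -/
theorem deltaCoind_apply_of_not_mem (hS : IsOpen (S : Set G)) (m : M) {x : G} (hx : x ∉ S) :
    ((deltaCoind S ρ hS m : coindModule (ρ.restrict (subgroupIncl S))) : C(G, M)) x = 0 := by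
  classical
  change (S : Set G).piecewise (fun x => ρ x m) 0 x = _
  rw [Set.piecewise_eq_of_notMem (S : Set G) (fun x => ρ x m) 0 (show x ∉ (S : Set G) from hx)]
  rfl

variable {S ρ}

omit [CompactSpace G] in
/-- **`(Σ_{j<p} T_γ^j δ_m)(1) = m`**: only the term `j = 0` contributes, the other translates of
`δ_m` being supported off `S`. [folklore] -/
theorem sum_coindTwist_pow_deltaCoind_apply_one {p : ℕ} (hp : p.Prime) (hidx : S.index = p) {γ : G}
    (hγ : γ ∉ S) (hS : IsOpen (S : Set G)) (m : M) :
    ((((Finset.range p).sum fun j => (coindTwist S ρ γ ^ j) (deltaCoind S ρ hS m)) :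
      coindModule (ρ.restrict (subgroupIncl S))) : C(G, M)) 1 = m := by
  haveI : Fact p.Prime := ⟨hp⟩
  have hcard : Nat.card (G ⧸ S) = p := by rw [← Subgroup.index_eq_card, hidx]
  have hord : orderOf (QuotientGroup.mk γ : G ⧸ S) = p := by
    refine orderOf_eq_prime ?_ fun h => hγ ((QuotientGroup.eq_one_iff γ).1 h)
    rw [← QuotientGroup.mk_pow, QuotientGroup.eq_one_iff, ← hidx]
    exact Subgroup.pow_index_mem S γ
  rw [Submodule.coe_sum, ContinuousMap.coe_sum, Finset.sum_apply,
    Finset.sum_eq_single_of_mem 0 (Finset.mem_range.2 hp.pos) fun j hj hj0 => ?_]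
  · rw [pow_zero, Module.End.one_apply, deltaCoind_apply_of_mem S ρ hS m S.one_mem, map_one,
      Module.End.one_apply]
  · rw [Finset.mem_range] at hj
    rw [coindTwist_pow, coindTwist_coe_apply, mul_one, deltaCoind_apply_of_not_mem S ρ hS m, map_zero]
    intro hmem
    have : (QuotientGroup.mk γ : G ⧸ S) ^ j = 1 := by
      rw [← QuotientGroup.mk_pow, QuotientGroup.eq_one_iff]
      simpa using S.inv_mem hmem
    exact pow_ne_one_of_lt_orderOf hj0 (hord ▸ hj) this

end Kernel

/-! ### The filtration `F_k = ker (T - 1)^k` and the sequences `0 → F_k → F_{k+1} → M → 0` -/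

section Filtration

omit [IsTopologicalGroup G] [CompactSpace G] [S.Normal] in
/-- `p` kills the induced module of a module killed by `p`. [folklore] -/
theorem prime_smul_coindModule_eq_zero {p : ℕ} (hpM : ∀ m : M, p • m = 0)
    (F : coindModule (ρ.restrict (subgroupIncl S))) : p • F = 0 :=
  Subtype.ext (ContinuousMap.ext fun x => by
    rw [Submodule.coe_smul_of_tower, ContinuousMap.coe_smul, Pi.smul_apply, hpM]; rfl)

/-- **The filtration** `F_k = ker (T_γ - 1)^k` of the induced module. [folklore] -/
def kerPow (γ : G) (k : ℕ) : Submodule ℤ (coindModule (ρ.restrict (subgroupIncl S))) :=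
  LinearMap.ker ((coindTwist S ρ γ - 1) ^ k)

omit [CompactSpace G] in
/-- Membership in `F_k`. [folklore] -/
theorem mem_kerPow_iff (γ : G) (k : ℕ) (F : coindModule (ρ.restrict (subgroupIncl S))) :
    F ∈ kerPow S ρ γ k ↔ ((coindTwist S ρ γ - 1) ^ k) F = 0 :=
  LinearMap.mem_ker

omit [CompactSpace G] in
/-- `F_k ≤ F_{k+1}`. [folklore] -/
theorem kerPow_mono (γ : G) (k : ℕ) : kerPow S ρ γ k ≤ kerPow S ρ γ (k + 1) := fun F hF => by
  rw [mem_kerPow_iff] at hF ⊢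
  rw [pow_succ', Module.End.mul_apply, hF, map_zero]

/-- `(T - 1)^k` commutes with the `G`-action. [folklore] -/
theorem commute_coindTwist_sub_one_pow (γ g : G) (k : ℕ) :
    Commute ((coindTwist S ρ γ - 1) ^ k) (coindRep (ρ.restrict (subgroupIncl S)) g) :=
  ((commute_coindTwist S ρ γ g).sub_left (Commute.one_left _)).pow_left k

/-- `F_k` is `G`-stable. [folklore] -/
theorem kerPow_le_comap (γ : G) (k : ℕ) (g : G) :
    kerPow S ρ γ k ≤ (kerPow S ρ γ k).comap (coindRep (ρ.restrict (subgroupIncl S)) g) := fun F hF => by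
  rw [Submodule.mem_comap, mem_kerPow_iff, ← Module.End.mul_apply, (commute_coindTwist_sub_one_pow S ρ γ g k).eq,
    Module.End.mul_apply, (mem_kerPow_iff S ρ γ k F).1 hF, map_zero]

/-- **`F_k` as a discrete `G`-module.** [folklore] -/
def kerPowRep (γ : G) (k : ℕ) : ContinuousRep G ℤ (kerPow S ρ γ k) :=
  (coindRep (ρ.restrict (subgroupIncl S))).subrepresentation (kerPow S ρ γ k) (kerPow_le_comap S ρ γ k)

/-- Unfolding the action on `F_k`. [folklore] -/
@[simp] theorem kerPowRep_apply_coe (γ : G) (k : ℕ) (g : G) (F : kerPow S ρ γ k) :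
    ((kerPowRep S ρ γ k g F : kerPow S ρ γ k) : coindModule (ρ.restrict (subgroupIncl S))) =
      coindRep (ρ.restrict (subgroupIncl S)) g F := rfl

/-- **The inclusion `F_k → F_{k+1}`.** [folklore] -/
def kerPowIncl (γ : G) (k : ℕ) : (kerPowRep S ρ γ k).toTopRep ⟶ (kerPowRep S ρ γ (k + 1)).toTopRep :=
  TopRep.ofHom
    { toLinearMap := Submodule.inclusion (kerPow_mono S ρ γ k)
      cont := continuous_of_discreteTopology
      isIntertwining' := fun g => by ext F; rfl }

/-- Unfolding the inclusion. [folklore] -/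
@[simp] theorem kerPowIncl_hom_apply_coe (γ : G) (k : ℕ) (F : kerPow S ρ γ k) :
    (((kerPowIncl S ρ γ k).hom F : kerPow S ρ γ (k + 1)) : coindModule (ρ.restrict (subgroupIncl S))) = F := rfl

variable {S ρ}
variable {p : ℕ} (hp : p.Prime) (hidx : S.index = p) {γ : G} (hγ : γ ∉ S)

omit [CompactSpace G] in
/-- For `F ∈ F_{k+1}`, `(T-1)^k F` lies in `ker (T - 1)`, hence is the unit of its value at `1`.
[folklore] -/
theorem coindTwist_pow_apply_eq_of_mem_kerPow_succ {k : ℕ} {F : coindModule (ρ.restrict (subgroupIncl S))}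
    (hF : F ∈ kerPow S ρ γ (k + 1)) :
    coindTwist S ρ γ (((coindTwist S ρ γ - 1) ^ k) F) = ((coindTwist S ρ γ - 1) ^ k) F := by
  rw [mem_kerPow_iff, pow_succ', Module.End.mul_apply, LinearMap.sub_apply, Module.End.one_apply, sub_eq_zero] at hF
  exact hF

include hp hidx hγ in
omit [CompactSpace G] in
/-- `((T-1)^k F)(g) = g · ((T-1)^k F)(1)` for `F ∈ F_{k+1}`. [folklore] -/
theorem coindTwist_pow_coe_apply_of_mem_kerPow_succ {k : ℕ} {F : coindModule (ρ.restrict (subgroupIncl S))}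
    (hF : F ∈ kerPow S ρ γ (k + 1)) (g : G) :
    ((((coindTwist S ρ γ - 1) ^ k) F : coindModule (ρ.restrict (subgroupIncl S))) : C(G, M)) g =
      ρ g (((((coindTwist S ρ γ - 1) ^ k) F : coindModule (ρ.restrict (subgroupIncl S))) : C(G, M)) 1) := by
  have h := congrArg (fun F' : coindModule (ρ.restrict (subgroupIncl S)) => (F' : C(G, M)) g)
    (eq_unitCoind_of_coindTwist_eq hp hidx hγ (coindTwist_pow_apply_eq_of_mem_kerPow_succ hF))
  simpa only [unitCoindFun_coe_apply] using h

/-- **The evaluation `Λ_k : F_{k+1} → M`, `F ↦ ((T-1)^k F)(1)`**, a morphism of discrete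
`G`-modules. [folklore] -/
def kerPowEval (k : ℕ) : (kerPowRep S ρ γ (k + 1)).toTopRep ⟶ ρ.toTopRep :=
  TopRep.ofHom
    { toLinearMap :=
        { toFun := fun F => (((((coindTwist S ρ γ - 1) ^ k) (F : coindModule (ρ.restrict (subgroupIncl S))) :
              coindModule (ρ.restrict (subgroupIncl S))) : C(G, M)) 1)
          map_add' := fun F F' => by
            rw [Submodule.coe_add, map_add, Submodule.coe_add, ContinuousMap.add_apply]
          map_smul' := fun c F => by
            rw [Submodule.coe_smul, map_zsmul, Submodule.coe_smul_of_tower, ContinuousMap.coe_smul, Pi.smul_apply,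
              RingHom.id_apply] }
      cont := continuous_of_discreteTopology
      isIntertwining' := fun g => by
        ext F
        change (((((coindTwist S ρ γ - 1) ^ k) (coindRep (ρ.restrict (subgroupIncl S)) g
            (F : coindModule (ρ.restrict (subgroupIncl S))))) : coindModule (ρ.restrict (subgroupIncl S))) :
            C(G, M)) 1 =
          ρ g ((((((coindTwist S ρ γ - 1) ^ k) (F : coindModule (ρ.restrict (subgroupIncl S)))) :
            coindModule (ρ.restrict (subgroupIncl S))) : C(G, M)) 1)
        rw [← Module.End.mul_apply, (commute_coindTwist_sub_one_pow S ρ γ g k).eq, Module.End.mul_apply,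
          coindRep_apply_apply, one_mul, coindTwist_pow_coe_apply_of_mem_kerPow_succ hp hidx hγ F.2] }

/-- Unfolding `Λ_k`. [folklore] -/
@[simp] theorem kerPowEval_hom_apply (k : ℕ) (F : kerPow S ρ γ (k + 1)) :
    (kerPowEval hp hidx hγ k).hom F =
      (((((coindTwist S ρ γ - 1) ^ k) (F : coindModule (ρ.restrict (subgroupIncl S))) :
        coindModule (ρ.restrict (subgroupIncl S))) : C(G, M)) 1) := rfl

/-- **The short exact sequences `0 → F_k → F_{k+1} → M → 0`** (`k < p`) of discrete `G`-modules
filtering the induced module `M_G^S(M) ≅ M ⊗ 𝔽_p[G/S]` of a module killed by `p` along a normal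
subgroup of index `p`. [cite: SerreGaloisCohomology1997, I §2.5; MilneADT2006, I §2 Thm. 2.8 (proof)] -/
theorem isSES_kerPow (hS : IsOpen (S : Set G)) (hpM : ∀ m : M, p • m = 0) {k : ℕ} (hk : k < p) :
    IsSES (kerPowIncl S ρ γ k) (kerPowEval hp hidx hγ k) := by
  have hpI := prime_smul_coindModule_eq_zero S ρ hpM
  refine ⟨?_, Submodule.inclusion_injective (kerPow_mono S ρ γ k), fun F hF => ?_, fun m => ?_⟩
  · ext F
    change (((((coindTwist S ρ γ - 1) ^ k) ((F : kerPow S ρ γ k) : coindModule (ρ.restrict (subgroupIncl S)))) :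
        coindModule (ρ.restrict (subgroupIncl S))) : C(G, M)) 1 = 0
    rw [(mem_kerPow_iff S ρ γ k _).1 F.2]; rfl
  · -- exactness in the middle: `(T-1)^k F` is fixed by `T` and vanishes at `1`
    have h0 : ((coindTwist S ρ γ - 1) ^ k) (F : coindModule (ρ.restrict (subgroupIncl S))) = 0 :=
      eq_zero_of_coindTwist_eq_of_apply_one hp hidx hγ (coindTwist_pow_apply_eq_of_mem_kerPow_succ F.2) hF
    exact ⟨⟨F, (mem_kerPow_iff S ρ γ k _).2 h0⟩, rfl⟩
  · -- surjectivity: `(T-1)^{p-1-k} δ_m`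
    have hδ : ((coindTwist S ρ γ - 1) ^ (p - 1 - k)) (deltaCoind S ρ hS m) ∈ kerPow S ρ γ (k + 1) := by
      rw [mem_kerPow_iff, ← Module.End.mul_apply, ← pow_add, show k + 1 + (p - 1 - k) = p by omega]
      exact sub_one_pow_prime_apply_eq_zero hp hpI _ (fun F => hidx ▸ coindTwist_pow_index S ρ γ F) _
    refine ⟨⟨_, hδ⟩, ?_⟩
    rw [kerPowEval_hom_apply, Subtype.coe_mk, ← Module.End.mul_apply, ← pow_add,
      show k + (p - 1 - k) = p - 1 by omega, sub_one_pow_prime_sub_one_apply hp hpI,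
      sum_coindTwist_pow_deltaCoind_apply_one hp hidx hγ hS m]

omit [CompactSpace G] in
/-- `F_0 = 0`. [folklore] -/
theorem kerPow_zero : kerPow S ρ γ 0 = ⊥ := by
  rw [kerPow, pow_zero]; exact LinearMap.ker_id

omit [CompactSpace G] in
include hp hidx in
/-- `F_p = M_G^S(M)` when `p M = 0`. [folklore] -/
theorem kerPow_prime_eq_top (hpM : ∀ m : M, p • m = 0) : kerPow S ρ γ p = ⊤ :=
  eq_top_iff.2 fun F _ => (mem_kerPow_iff S ρ γ p F).2
    (sub_one_pow_prime_apply_eq_zero hp (prime_smul_coindModule_eq_zero S ρ hpM) _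
      (fun F => hidx ▸ coindTwist_pow_index S ρ γ F) F)

omit [CompactSpace G] in
/-- `F_k` is killed by `p`. [folklore] -/
theorem prime_smul_kerPow_eq_zero (hpM : ∀ m : M, p • m = 0) (k : ℕ) (F : kerPow S ρ γ k) : p • F = 0 :=
  Subtype.ext (by rw [Submodule.coe_smul_of_tower, prime_smul_coindModule_eq_zero S ρ hpM, Submodule.coe_zero])

end Filtration

/-! ### Generic counting and transport lemmas -/

section Generic

variable {Γ : Type u} [Group Γ] [TopologicalSpace Γ] [IsTopologicalGroup Γ]

/-- `H¹` of a zero module vanishes. [folklore] -/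
theorem subsingleton_continuousCohomology_one_of_subsingleton (X : TopRep.{u} ℤ Γ) [Subsingleton X] :
    Subsingleton (continuousCohomology 1 X) :=
  ⟨fun a b => by
    obtain ⟨φ, rfl⟩ := oneCocycleClass_surjective X a
    obtain ⟨ψ, rfl⟩ := oneCocycleClass_surjective X b
    rw [show φ = ψ from Subtype.ext (ContinuousMap.ext fun _ => Subsingleton.elim _ _)]⟩

/-- `H²` of a zero module vanishes. [folklore] -/
theorem subsingleton_continuousCohomology_two_of_subsingleton [LocallyCompactSpace Γ] (X : TopRep.{u} ℤ Γ)
    [Subsingleton X] : Subsingleton (continuousCohomology 2 X) :=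
  ⟨fun a b => by
    obtain ⟨φ, rfl⟩ := twoCocycleClass_surjective X a
    obtain ⟨ψ, rfl⟩ := twoCocycleClass_surjective X b
    rw [show φ = ψ from Subtype.ext (ContinuousMap.ext fun _ => Subsingleton.elim _ _)]⟩

/-- A group in the middle of an exact `A → B → C` with `A, C` finite is finite. [folklore] -/
theorem finite_of_exact {A B C : Type*} [AddCommGroup A] [AddCommGroup B] [AddCommGroup C]
    [Finite A] [Finite C] (φ : A →+ B) (ψ : B →+ C) (hexact : ∀ b, ψ b = 0 → ∃ a, φ a = b) : Finite B := by
  haveI := Fintype.ofFinite A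
  haveI := Fintype.ofFinite C
  letI : Fintype B := AddGroup.fintypeOfKerLeRange φ ψ fun b hb => hexact b hb
  exact Finite.of_fintype B

/-- **Invariants are invariant under isomorphisms of topological modules.** [folklore] -/
def invariantsEquivOfIso {V₁ : Type u} [AddCommGroup V₁] [TopologicalSpace V₁] [DiscreteTopology V₁]
    {V₂ : Type u} [AddCommGroup V₂] [TopologicalSpace V₂] [DiscreteTopology V₂]
    {τ₁ : ContinuousRep Γ ℤ V₁} {τ₂ : ContinuousRep Γ ℤ V₂} (e : τ₁.toTopRep ≅ τ₂.toTopRep) :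
    τ₁.toTopRep.ρ.invariants ≃ τ₂.toTopRep.ρ.invariants where
  toFun v := ⟨e.hom.hom v, fun g => by
    change τ₂ g (e.hom.hom v) = e.hom.hom v
    rw [← ContinuousRep.hom_comm_apply e.hom g, show τ₁ g v = v from v.2 g]⟩
  invFun w := ⟨e.inv.hom w, fun g => by
    change τ₁ g (e.inv.hom w) = e.inv.hom w
    rw [← ContinuousRep.hom_comm_apply e.inv g, show τ₂ g w = w from w.2 g]⟩
  left_inv v := Subtype.ext (by
    change e.inv.hom (e.hom.hom v) = v
    rw [← TopRep.comp_apply, e.hom_inv_id, TopRep.id_apply])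
  right_inv w := Subtype.ext (by
    change e.hom.hom (e.inv.hom w) = w
    rw [← TopRep.comp_apply, e.inv_hom_id, TopRep.id_apply])

end Generic

/-! ### Shapiro, numerically -/

section Shapiro

variable [T2Space G] [TotallyDisconnectedSpace G]

/-- **Shapiro's lemma as a bijection** `H^{q+1}(G, M_G^S(M)) ≃ H^{q+1}(S, M)` for a closed subgroup
`S` of a profinite group. [cite: SerreGaloisCohomology1997, I §2.5 Prop. 10] -/
def shapiroEquiv [IsClosed (S : Set G)] (q : ℕ) :
    continuousCohomology (q + 1) (coindRep (ρ.restrict (subgroupIncl S))).toTopRep ≃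
      continuousCohomology (q + 1) (ρ.restrict (subgroupIncl S)).toTopRep where
  toFun := shMap S ρ (q + 1)
  invFun := extMap S ρ (q + 1)
  left_inv := extMap_sh S ρ q
  right_inv := sh_extMap S ρ (q + 1)

omit [T2Space G] [TotallyDisconnectedSpace G] in
/-- **Shapiro in degree `0`**: `M_G^S(M)^G ≃ M^S`, `F ↦ F(1)`. [cite: SerreGaloisCohomology1997, I §2.5] -/
def invariantsCoindEquiv :
    (coindRep (ρ.restrict (subgroupIncl S))).toTopRep.ρ.invariants ≃
      (ρ.restrict (subgroupIncl S)).toTopRep.ρ.invariants where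
  toFun F := ⟨((F : coindModule (ρ.restrict (subgroupIncl S))) : C(G, M)) 1, fun s => by
    have hinv : ((coindRep (ρ.restrict (subgroupIncl S)) (s : G) (F : coindModule (ρ.restrict (subgroupIncl S))) :
        coindModule (ρ.restrict (subgroupIncl S))) : C(G, M)) 1 =
        ((F : coindModule (ρ.restrict (subgroupIncl S))) : C(G, M)) 1 :=
      congrArg (fun F' : coindModule (ρ.restrict (subgroupIncl S)) => (F' : C(G, M)) 1) (F.2 (s : G))
    rw [coindRep_apply_apply, one_mul] at hinv
    have key := (mem_coind_iff (ρ.restrict (subgroupIncl S)) _).1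
      (F : coindModule (ρ.restrict (subgroupIncl S))).2 s 1
    rw [mul_one, hinv] at key
    exact key.symm⟩
  invFun m := ⟨⟨ContinuousMap.const G (m : M), fun s x => by
      change (m : M) = (ρ.restrict (subgroupIncl S)) s m
      exact (m.2 s).symm⟩, fun g => Subtype.ext (ContinuousMap.ext fun x => rfl)⟩
  left_inv F := Subtype.ext (Subtype.ext (ContinuousMap.ext fun x => by
    have hinv : ((coindRep (ρ.restrict (subgroupIncl S)) x (F : coindModule (ρ.restrict (subgroupIncl S))) :
        coindModule (ρ.restrict (subgroupIncl S))) : C(G, M)) 1 =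
        ((F : coindModule (ρ.restrict (subgroupIncl S))) : C(G, M)) 1 :=
      congrArg (fun F' : coindModule (ρ.restrict (subgroupIncl S)) => (F' : C(G, M)) 1) (F.2 x)
    rw [coindRep_apply_apply, one_mul] at hinv
    exact hinv.symm))
  right_inv m := rfl

end Shapiro

/-! ### The count -/

section Count

variable [T2Space G] [TotallyDisconnectedSpace G]
variable {S ρ}
variable {p : ℕ} (hp : p.Prime) (hidx : S.index = p) {γ : G} (hγ : γ ∉ S) (hS : IsOpen (S : Set G))
  (hpM : ∀ m : M, p • m = 0)
  (h3 : ∀ {V : Type u} [AddCommGroup V] [TopologicalSpace V] [DiscreteTopology V] (τ : ContinuousRep G ℤ V),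
    (∀ v : V, p • v = 0) → Subsingleton (continuousCohomology 3 τ.toTopRep))

omit [T2Space G] [TotallyDisconnectedSpace G] in
include hp hidx hγ hS hpM h3 in
/-- **The inductive count along the filtration**: `H¹(G, F_k)`, `H²(G, F_k)` are finite and
`#F_k^G · #H²(F_k) · h¹(M)^k = #H¹(F_k) · (#M^G · #H²(M))^k` for `k ≤ p`. [cite: MilneADT2006, I §2 Thm. 2.8 (proof)] -/
theorem finite_and_card_kerPow [Finite M] [Finite (continuousCohomology 1 ρ.toTopRep)]
    [Finite (continuousCohomology 2 ρ.toTopRep)] (k : ℕ) (hk : k ≤ p) :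
    Finite (continuousCohomology 1 (kerPowRep S ρ γ k).toTopRep) ∧
    Finite (continuousCohomology 2 (kerPowRep S ρ γ k).toTopRep) ∧
    Nat.card (kerPowRep S ρ γ k).toTopRep.ρ.invariants *
        Nat.card (continuousCohomology 2 (kerPowRep S ρ γ k).toTopRep) *
        Nat.card (continuousCohomology 1 ρ.toTopRep) ^ k =
      Nat.card (continuousCohomology 1 (kerPowRep S ρ γ k).toTopRep) *
        (Nat.card ρ.toTopRep.ρ.invariants * Nat.card (continuousCohomology 2 ρ.toTopRep)) ^ k := by
  haveI : Finite (coindModule (ρ.restrict (subgroupIncl S))) := finite_coindModule_of_index_prime hp hidx hγ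
  induction k with
  | zero =>
    haveI : Subsingleton (kerPow S ρ γ 0) := by
      rw [kerPow_zero]; infer_instance
    haveI : Subsingleton (kerPowRep S ρ γ 0).toTopRep := ‹Subsingleton (kerPow S ρ γ 0)›
    haveI := subsingleton_continuousCohomology_one_of_subsingleton (kerPowRep S ρ γ 0).toTopRep
    haveI := subsingleton_continuousCohomology_two_of_subsingleton (kerPowRep S ρ γ 0).toTopRep
    haveI : Subsingleton (kerPowRep S ρ γ 0).toTopRep.ρ.invariants := inferInstance
    refine ⟨inferInstance, inferInstance, ?_⟩
    rw [pow_zero, pow_zero, mul_one, mul_one, Nat.card_of_subsingleton (0 : (kerPowRep S ρ γ 0).toTopRep.ρ.invariants),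
      Nat.card_of_subsingleton (0 : continuousCohomology 2 (kerPowRep S ρ γ 0).toTopRep),
      Nat.card_of_subsingleton (0 : continuousCohomology 1 (kerPowRep S ρ γ 0).toTopRep)]
  | succ k ih =>
    obtain ⟨hf1, hf2, hcount⟩ := ih (k.le_succ.trans hk)
    have h := isSES_kerPow (ρ := ρ) hp hidx hγ hS hpM (Nat.lt_of_succ_le hk)
    haveI := h3 (kerPowRep S ρ γ k) (prime_smul_kerPow_eq_zero hpM k)
    -- finiteness of `H¹(F_{k+1})`, `H²(F_{k+1})` by exactness
    haveI : Finite (continuousCohomology 1 (kerPowRep S ρ γ (k + 1)).toTopRep) :=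
      finite_of_exact (cohomologyMap (kerPowIncl S ρ γ k) 1).hom.toLinearMap.toAddMonoidHom
        (cohomologyMap (kerPowEval hp hidx hγ k) 1).hom.toLinearMap.toAddMonoidHom
        fun y hy => h.exists_map_one_eq_of_map_one_eq_zero y hy
    haveI : Finite (continuousCohomology 2 (kerPowRep S ρ γ (k + 1)).toTopRep) :=
      finite_of_exact (cohomologyMap (kerPowIncl S ρ γ k) 2).hom.toLinearMap.toAddMonoidHom
        (cohomologyMap (kerPowEval hp hidx hγ k) 2).hom.toLinearMap.toAddMonoidHom
        fun y hy => h.exists_map_two_eq_of_map_two_eq_zero y hy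
    refine ⟨inferInstance, inferInstance, ?_⟩
    have e1 := h.card_nineTerm
    have hb : 0 < Nat.card (continuousCohomology 1 (kerPowRep S ρ γ k).toTopRep) := Nat.card_pos
    -- pure arithmetic
    generalize Nat.card (kerPowRep S ρ γ k).toTopRep.ρ.invariants = x0 at e1 hcount
    generalize Nat.card (continuousCohomology 1 (kerPowRep S ρ γ k).toTopRep) = x1 at e1 hcount hb
    generalize Nat.card (continuousCohomology 2 (kerPowRep S ρ γ k).toTopRep) = x2 at e1 hcount
    generalize Nat.card (kerPowRep S ρ γ (k + 1)).toTopRep.ρ.invariants = y0 at e1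
    generalize Nat.card (continuousCohomology 1 (kerPowRep S ρ γ (k + 1)).toTopRep) = y1 at e1
    generalize Nat.card (continuousCohomology 2 (kerPowRep S ρ γ (k + 1)).toTopRep) = y2 at e1
    generalize Nat.card ρ.toTopRep.ρ.invariants = mg at e1 hcount
    generalize Nat.card (continuousCohomology 1 ρ.toTopRep) = n1 at e1 hcount
    generalize Nat.card (continuousCohomology 2 ρ.toTopRep) = m2 at e1 hcount
    refine Nat.eq_of_mul_eq_mul_left hb ?_
    calc x1 * (y0 * y2 * n1 ^ (k + 1)) = (y0 * x1 * n1 * y2) * n1 ^ k := by ring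
      _ = (x0 * mg * y1 * x2 * m2) * n1 ^ k := by rw [e1]
      _ = (x0 * x2 * n1 ^ k) * (mg * m2 * y1) := by ring
      _ = (x1 * (mg * m2) ^ k) * (mg * m2 * y1) := by rw [hcount]
      _ = x1 * (y1 * (mg * m2) ^ (k + 1)) := by ring

/-- The identification `F_p = M_G^S(M)` as an isomorphism of topological `G`-modules. [folklore] -/
def kerPowTopIso (hpM : ∀ m : M, p • m = 0) :
    (kerPowRep S ρ γ p).toTopRep ≅ (coindRep (ρ.restrict (subgroupIncl S))).toTopRep :=
  topRepIsoOfEquiv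
    { LinearEquiv.ofTop (kerPow S ρ γ p) (kerPow_prime_eq_top hp hidx hpM) with
      continuous_toFun := continuous_of_discreteTopology
      continuous_invFun := continuous_of_discreteTopology }
    fun _ _ => rfl

include hp hidx hγ hS hpM h3 in
/-- **Finiteness of `H¹(S, M)`** for `S ⊴ G` open of prime index `p`, `M` finite killed by `p` with
`H¹(G, M)`, `H²(G, M)` finite and `H³(G, ·) = 0` on `p`-torsion modules. [cite: SerreGaloisCohomology1997, II §5.7] -/
theorem finite_continuousCohomology_restrict_one [Finite M] [Finite (continuousCohomology 1 ρ.toTopRep)]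
    [Finite (continuousCohomology 2 ρ.toTopRep)] :
    Finite (continuousCohomology 1 (ρ.restrict (subgroupIncl S)).toTopRep) := by
  haveI : IsClosed (S : Set G) := Subgroup.isClosed_of_isOpen S hS
  haveI := (finite_and_card_kerPow (ρ := ρ) hp hidx hγ hS hpM h3 p le_rfl).1
  exact Finite.of_equiv _ ((continuousCohomologyEquivOfIso (kerPowTopIso (ρ := ρ) (γ := γ) hp hidx hpM) 1).trans
    (shapiroEquiv S ρ 0))

include hp hidx hγ hS hpM h3 in
/-- **Finiteness of `H²(S, M)`** under the same hypotheses. [cite: SerreGaloisCohomology1997, II §5.7] -/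
theorem finite_continuousCohomology_restrict_two [Finite M] [Finite (continuousCohomology 1 ρ.toTopRep)]
    [Finite (continuousCohomology 2 ρ.toTopRep)] :
    Finite (continuousCohomology 2 (ρ.restrict (subgroupIncl S)).toTopRep) := by
  haveI : IsClosed (S : Set G) := Subgroup.isClosed_of_isOpen S hS
  haveI := (finite_and_card_kerPow (ρ := ρ) hp hidx hγ hS hpM h3 p le_rfl).2.1
  exact Finite.of_equiv _ ((continuousCohomologyEquivOfIso (kerPowTopIso (ρ := ρ) (γ := γ) hp hidx hpM) 2).trans
    (shapiroEquiv S ρ 1))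

include hp hidx hγ hS hpM h3 in
/-- **The Euler–Poincaré characteristic in a cyclic step of prime degree.** For a profinite group
`G`, an open normal subgroup `S` of prime index `p`, and a finite discrete `G`-module `M` killed by
`p` with `H¹(G, M)`, `H²(G, M)` finite and `H³(G, ·) = 0` on discrete modules killed by `p`:
`#M^S · #H²(S, M) · #H¹(G, M)^p = #H¹(S, M) · (#M^G · #H²(G, M))^p`, i.e.
`χ(S, M) = χ(G, M)^p` for the truncated Euler–Poincaré characteristic `χ = h⁰ h² / h¹`
(filtration of the induced module, Shapiro's lemma and the nine-term count).
[cite: SerreGaloisCohomology1997, II §5.7 (dévissage, Lemme 7)] [cite: MilneADT2006, I §2 Thm. 2.8 (proof)] -/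
theorem card_euler_cyclic_step [Finite M] [Finite (continuousCohomology 1 ρ.toTopRep)]
    [Finite (continuousCohomology 2 ρ.toTopRep)] :
    Nat.card (ρ.restrict (subgroupIncl S)).toTopRep.ρ.invariants *
        Nat.card (continuousCohomology 2 (ρ.restrict (subgroupIncl S)).toTopRep) *
        Nat.card (continuousCohomology 1 ρ.toTopRep) ^ p =
      Nat.card (continuousCohomology 1 (ρ.restrict (subgroupIncl S)).toTopRep) *
        (Nat.card ρ.toTopRep.ρ.invariants * Nat.card (continuousCohomology 2 ρ.toTopRep)) ^ p := by
  haveI : IsClosed (S : Set G) := Subgroup.isClosed_of_isOpen S hS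
  obtain ⟨-, -, hcount⟩ := finite_and_card_kerPow (ρ := ρ) hp hidx hγ hS hpM h3 p le_rfl
  rw [Nat.card_congr ((invariantsEquivOfIso (kerPowTopIso (ρ := ρ) (γ := γ) hp hidx hpM)).trans (invariantsCoindEquiv S ρ)),
    Nat.card_congr ((continuousCohomologyEquivOfIso (kerPowTopIso (ρ := ρ) (γ := γ) hp hidx hpM) 2).trans (shapiroEquiv S ρ 1)),
    Nat.card_congr ((continuousCohomologyEquivOfIso (kerPowTopIso (ρ := ρ) (γ := γ) hp hidx hpM) 1).trans (shapiroEquiv S ρ 0))]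
    at hcount
  exact hcount

end Count

end Literature.NumberTheory.GaloisRepresentations

end
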